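import Mathlib
import HarnessLib
import Literature.Analysis.FluidPDE.ClassicalSolution
import Literature.Analysis.FluidPDE.TaoLocalisation
import Literature.Analysis.FluidPDE.TaoEnstrophyLocalisationProofs
import Literature.Analysis.FluidPDE.NSWeakStrongUniquenessProofs
import Literature.Analysis.FluidPDE.WholeSpaceIBP
import Literature.Analysis.FluidPDE.LerayHopfProofs

/-!
# Shelf 1574, LINE 9 «trace_transfer»: STUB 2 — the slice law bounds the cubic mass above the
# self-similar threshold (Sobolev `Ḣ¹ ⊂ L⁶` + Chebyshev in `L⁶`)

Helper file (`--supports stmt-NavierStokesRegularity-1574 --as helper`) for the banked line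
`Cruxes/EnstrophyQuarterLaw/Lines/trace_transfer.lean` (ns-idea-9 g4, LINE 9; idea-crit-8 V35
PASS-WITH-PRICE «corollary grade»; KEY-NS #131 (1) / #136 (1): typed cross-route edge 1574 ⇒ 18384/18385).
The main statement is the line's registered `stub_fastL3` with its Cruxes-local predicates `SliceLaw`,
`FastL3Bound` UNFOLDED VERBATIM (size M):

  slice law `∫ |curl u(t)|² ≤ K/√(T−t)` on `[0,T)` ⇒ `∫_{|u(s)| > (T−s)^{-1/2}} |u(s)|³ ≤ C` on `[0,T)`,

with the explicit constant `C = C_S⁶ (max K 0)³` (`C_S` = Mathlib's Sobolev constant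
`SNormLESNormFDerivOfEqConst` of `H¹(ℝ³) ⊂ L⁶`). PROOF (the FAST PART of the line, step 2 of its module
docstring): on the fast set `|u| > λ = (T−s)^{-1/2}` one has `|u|³ ≤ λ⁻³|u|⁶ = (T−s)^{3/2}|u|⁶`, and
`‖u(s)‖₆⁶ ≤ C_S⁶ (∫|∇u(s)|²)³ ≤ C_S⁶ (∫|curl u(s)|²)³ ≤ C_S⁶ K³ (T−s)^{-3/2}` by the whole-space Sobolev
inequality for `H¹` fields (`eLpNorm_six_le_frobenius_of_hasWeakGradient`) and the div–curl estimate
(`lintegral_frobeniusNormSq_fderiv_le_lintegral_sq_norm_curl`); the powers of `T − s` cancel EXACTLY (the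
criticality recorded by idea-crit-8 V35-P2: zero slack at the shelf exponent 1/2). Template: the tree's
`…Theorems.EnstrophyQuarterLaw.LambBudget.volume_fastSet_le_of_slice` (Chebyshev for the VOLUME of the fast
set; here the cubic MASS). The rapid-decay hypothesis of the registered signature is idle.

No summit statement is proved: `EnstrophyQuarterLaw` (1574), `TraceScarL3` (18384), `TypeITraceScarL3`
(18385) stay OPEN; nothing here proves NS regularity.
-/

noncomputable section

-- the summit-side namespace repeats a component by design (D-0017)
set_option linter.dupNamespace false

namespace Summit.NavierStokesRegularity.NavierStokesRegularity.Theorems.EnstrophyQuarterLaw.TraceTransfer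

open Set MeasureTheory Function Metric Filter Topology
open scoped ENNReal NNReal
open Literature.Analysis.FluidPDE

variable {ν T : ℝ} {u : ℝ → EuclideanSpace ℝ (Fin 3) → EuclideanSpace ℝ (Fin 3)}
  {p : ℝ → EuclideanSpace ℝ (Fin 3) → ℝ}

/-- **Cubic mass above a level, one slice (Sobolev–Chebyshev).** For a classical solution on `[0, T)`
(`ν > 0`), Leray–Hopf on `[0, T]`, with `∫ |curl u(s)|² ≤ K/√(T − s)` at some `s ∈ [0, T)` (`K ≥ 0`):
`∫_{|u(s)| > (√(T−s))⁻¹} |u(s)|³ ≤ C_S⁶ K³` — on the fast set `|u|³ ≤ (√(T−s))³ |u|⁶`, and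
`∫|u(s)|⁶ ≤ C_S⁶ (∫|∇u(s)|²)³ ≤ C_S⁶ (K/√(T−s))³`. [folklore] -/
theorem setLIntegral_cube_fastSet_le_of_slice (hν : 0 < ν)
    (hsol : IsClassicalNSSolutionOn (Ico 0 T) ν 0 u p) (hLH : IsLerayHopfOn T ν 0 (u 0) u)
    {K : ℝ} (hK : 0 ≤ K) {s : ℝ} (hs : s ∈ Ico 0 T)
    (hslice : ∫⁻ x, ‖curl (u s) x‖ₑ ^ 2 ≤ ENNReal.ofReal (K / Real.sqrt (T - s))) :
    ∫⁻ x in {x : EuclideanSpace ℝ (Fin 3) | (Real.sqrt (T - s))⁻¹ < ‖u s x‖}, ‖u s x‖ₑ ^ 3 ≤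
      ENNReal.ofReal (((SNormLESNormFDerivOfEqConst (EuclideanSpace ℝ (Fin 3))
          (volume : Measure (EuclideanSpace ℝ (Fin 3))) 2 : ℝ≥0) : ℝ) ^ 6 * K ^ 3) := by
  -- the Sobolev constant of `H¹(ℝ³) ⊂ L⁶`
  set CS : ℝ≥0 := SNormLESNormFDerivOfEqConst (EuclideanSpace ℝ (Fin 3))
    (volume : Measure (EuclideanSpace ℝ (Fin 3))) 2 with hCS
  have hτ : 0 < T - s := sub_pos.2 hs.2
  set b : ℝ := Real.sqrt (T - s) with hb
  have hbpos : 0 < b := Real.sqrt_pos.2 hτ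
  -- the slice: `C¹`, in `L²`, with `∫ |∇u(s)|² ≤ K / b`
  have hC2 : ContDiff ℝ 2 (u s) := (hsol.contDiff_velocity hs).of_le (by norm_cast)
  have hC1 : ContDiff ℝ 1 (u s) := hC2.of_le (by norm_cast)
  have hmem : MemLp (u s) 2 volume := hLH.memLp s ⟨hs.1, hs.2.le⟩
  have hL2 : ∫⁻ x, ‖u s x‖ₑ ^ 2 < ⊤ :=
    lt_of_le_of_lt (hLH.lintegral_enorm_sq_le hν.le ⟨hs.1, hs.2.le⟩) ENNReal.ofReal_lt_top
  set D : ℝ≥0∞ := ∫⁻ x, ENNReal.ofReal (frobeniusNormSq (fderiv ℝ (u s) x)) with hD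
  have hDle : D ≤ ENNReal.ofReal (K / b) :=
    (lintegral_frobeniusNormSq_fderiv_le_lintegral_sq_norm_curl hC2 (hsol.divFree s hs) hL2).trans hslice
  -- Sobolev: `‖u(s)‖₆⁶ ≤ C_S⁶ (K/b)³`
  have h6 : eLpNorm (u s) 6 volume ≤ (CS : ℝ≥0∞) * D ^ (1 / 2 : ℝ) :=
    eLpNorm_six_le_frobenius_of_hasWeakGradient finrank_euclideanSpace_fin hmem
      (hasWeakGradient_fderiv_of_contDiff hC1)
  have h6' : eLpNorm (u s) 6 volume ^ (6 : ℝ) ≤ ENNReal.ofReal ((CS : ℝ) ^ 6 * (K / b) ^ 3) := by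
    calc eLpNorm (u s) 6 volume ^ (6 : ℝ)
        ≤ ((CS : ℝ≥0∞) * D ^ (1 / 2 : ℝ)) ^ (6 : ℝ) := ENNReal.rpow_le_rpow h6 (by norm_num)
      _ = (CS : ℝ≥0∞) ^ (6 : ℝ) * D ^ (3 : ℝ) := by
          rw [ENNReal.mul_rpow_of_nonneg _ _ (by norm_num), ← ENNReal.rpow_mul]
          norm_num
      _ ≤ (CS : ℝ≥0∞) ^ (6 : ℝ) * ENNReal.ofReal (K / b) ^ (3 : ℝ) := by gcongr
      _ = ENNReal.ofReal ((CS : ℝ) ^ 6 * (K / b) ^ 3) := by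
          rw [show ((CS : ℝ≥0) : ℝ≥0∞) = ENNReal.ofReal (CS : ℝ) from (ENNReal.ofReal_coe_nnreal).symm,
            ENNReal.ofReal_rpow_of_nonneg (by positivity) (by norm_num),
            ENNReal.ofReal_rpow_of_nonneg (by positivity) (by norm_num),
            ← ENNReal.ofReal_mul (by positivity)]
          congr 1
          rw [show (6 : ℝ) = ((6 : ℕ) : ℝ) by norm_num, show (3 : ℝ) = ((3 : ℕ) : ℝ) by norm_num,
            Real.rpow_natCast, Real.rpow_natCast]
  -- `∫ |u(s)|⁶ = ‖u(s)‖₆⁶`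
  have h66 : ∫⁻ x, ‖u s x‖ₑ ^ 6 = eLpNorm (u s) 6 volume ^ (6 : ℝ) := by
    have h := eLpNorm_natCast_pow_eq_lintegral volume (u s) (n := 6) (by norm_num)
    simp only [Nat.cast_ofNat] at h
    rw [← h, show (6 : ℝ) = ((6 : ℕ) : ℝ) by norm_num, ENNReal.rpow_natCast]
  -- the fast set is open, hence measurable
  have hA : MeasurableSet {x : EuclideanSpace ℝ (Fin 3) | (Real.sqrt (T - s))⁻¹ < ‖u s x‖} :=
    (isOpen_lt continuous_const hC1.continuous.norm).measurableSet
  -- on the fast set `|u|³ ≤ b³ |u|⁶`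
  have hpt : ∀ x ∈ {x : EuclideanSpace ℝ (Fin 3) | (Real.sqrt (T - s))⁻¹ < ‖u s x‖},
      ‖u s x‖ₑ ^ 3 ≤ ENNReal.ofReal (b ^ 3) * ‖u s x‖ₑ ^ 6 := by
    intro x hx
    have hx' : b⁻¹ < ‖u s x‖ := hx
    have ha : 0 ≤ ‖u s x‖ := norm_nonneg _
    have hab : 1 < b * ‖u s x‖ := by
      have h1 : b⁻¹ * b < ‖u s x‖ * b := mul_lt_mul_of_pos_right hx' hbpos
      rw [inv_mul_cancel₀ hbpos.ne'] at h1
      linarith [mul_comm (‖u s x‖) b]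
    have hreal : ‖u s x‖ ^ 3 ≤ b ^ 3 * ‖u s x‖ ^ 6 := by
      calc ‖u s x‖ ^ 3 ≤ ‖u s x‖ ^ 3 * (b * ‖u s x‖) ^ 3 :=
            le_mul_of_one_le_right (pow_nonneg ha 3) (one_le_pow₀ hab.le)
        _ = b ^ 3 * ‖u s x‖ ^ 6 := by ring
    rw [← ofReal_norm, ← ENNReal.ofReal_pow ha, ← ENNReal.ofReal_pow ha,
      ← ENNReal.ofReal_mul (by positivity)]
    exact ENNReal.ofReal_le_ofReal hreal
  calc ∫⁻ x in {x : EuclideanSpace ℝ (Fin 3) | (Real.sqrt (T - s))⁻¹ < ‖u s x‖}, ‖u s x‖ₑ ^ 3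
      ≤ ∫⁻ x in {x : EuclideanSpace ℝ (Fin 3) | (Real.sqrt (T - s))⁻¹ < ‖u s x‖},
          ENNReal.ofReal (b ^ 3) * ‖u s x‖ₑ ^ 6 := setLIntegral_mono' hA hpt
    _ ≤ ∫⁻ x, ENNReal.ofReal (b ^ 3) * ‖u s x‖ₑ ^ 6 := setLIntegral_le_lintegral _ _
    _ = ENNReal.ofReal (b ^ 3) * ∫⁻ x, ‖u s x‖ₑ ^ 6 :=
        lintegral_const_mul' _ _ ENNReal.ofReal_ne_top
    _ = ENNReal.ofReal (b ^ 3) * eLpNorm (u s) 6 volume ^ (6 : ℝ) := by rw [h66]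
    _ ≤ ENNReal.ofReal (b ^ 3) * ENNReal.ofReal ((CS : ℝ) ^ 6 * (K / b) ^ 3) := by gcongr
    _ = ENNReal.ofReal ((CS : ℝ) ^ 6 * K ^ 3) := by
        rw [← ENNReal.ofReal_mul (by positivity)]
        congr 1
        field_simp

/-- **STUB 2 of LINE 9 «trace_transfer», registered signature with `SliceLaw` / `FastL3Bound` unfolded
verbatim** (the FAST PART): for `ν > 0`, `T > 0`, `(u, p)` classical on `[0, T) × ℝ³`, Leray–Hopf on `[0, T]`
from the (rapidly decaying) datum `u 0`, the slice law `∫ |curl u(t)|² ≤ K/√(T−t)` on `[0, T)` bounds the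
cubic mass above the self-similar threshold: `∫_{|u(s)| > (√(T−s))⁻¹} |u(s)|³ ≤ C` for all `s ∈ [0, T)`, with
`C = C_S⁶ (max K 0)³`. [folklore] -/
theorem stub_fastL3 :
    ∀ (ν T : ℝ), 0 < ν → 0 < T →
      ∀ (u : ℝ → EuclideanSpace ℝ (Fin 3) → EuclideanSpace ℝ (Fin 3)) (p : ℝ → EuclideanSpace ℝ (Fin 3) → ℝ),
        IsClassicalNSSolutionOn (Set.Ico 0 T) ν 0 u p → IsLerayHopfOn T ν 0 (u 0) u →
        HasRapidSpatialDecay (u 0) → ∀ K : ℝ,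
        (∀ t ∈ Set.Ico 0 T, ∫⁻ x, ‖curl (u t) x‖ₑ ^ 2 ≤ ENNReal.ofReal (K / Real.sqrt (T - t))) →
        ∃ C : ℝ, ∀ s ∈ Set.Ico 0 T,
          ∫⁻ x in {x | (Real.sqrt (T - s))⁻¹ < ‖u s x‖}, ‖u s x‖ₑ ^ 3 ≤ ENNReal.ofReal C := by
  intro ν T hν _hT u p hsol hLH _hdec K hK
  set K' : ℝ := max K 0 with hK'
  have hK'0 : 0 ≤ K' := le_max_right _ _
  have hK'slice : ∀ t ∈ Ico 0 T,
      ∫⁻ x, ‖curl (u t) x‖ₑ ^ 2 ≤ ENNReal.ofReal (K' / Real.sqrt (T - t)) :=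
    fun t ht => (hK t ht).trans
      (ENNReal.ofReal_le_ofReal (div_le_div_of_nonneg_right (le_max_left _ _) (Real.sqrt_nonneg _)))
  exact ⟨((SNormLESNormFDerivOfEqConst (EuclideanSpace ℝ (Fin 3))
      (volume : Measure (EuclideanSpace ℝ (Fin 3))) 2 : ℝ≥0) : ℝ) ^ 6 * K' ^ 3, fun s hs =>
    setLIntegral_cube_fastSet_le_of_slice hν hsol hLH hK'0 hs (hK'slice s hs)⟩

end Summit.NavierStokesRegularity.NavierStokesRegularity.Theorems.EnstrophyQuarterLaw.TraceTransfer

end
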